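import Mathlib
import Summits.NavierStokesRegularity.NavierStokesRegularity.Theses.SubOnsagerCeiling
import Summits.NavierStokesRegularity.NavierStokesRegularity.Theorems.SubOnsagerCeilingKPLargeDataTarget
import HarnessLib

/-!
# Route SubOnsagerCeiling — the LARGE-DATA, UNIT-VISCOSITY, SMALL-RATIO KP ceiling as a named proposition
# (definitions file towards a re-typing of the crux `ForwardTailCeilingKP`, item stmt-NavierStokesRegularity-27057; D-0016:
# an object a prover recommends to the planner is reviewed, never buried in a proof file; hand leafhand-ns-subonsagerceiling-4 gen 25)

`KPLargeDataSmallRatioCeiling` is, VERBATIM, the hypothesis `hL` of the landed reduction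
`Theorems.SubOnsagerCeiling.LargeData.taoLadderTarget_of_kpLargeDataSmallRatioCeiling` (`Theorems/SubOnsagerCeilingKPLargeDataTarget.lean`):
the forward-source tail ceiling of the crux `Theses.SubOnsagerCeiling.ForwardTailCeilingKP` with three quantifiers removed —
SMALL scale ratios only (`∀ R ≥ 1, ∃ εR > 0, ∀ ε₀ ∈ (0, εR]`; gen 22), UNIT viscosity only (`ν = 1`; amplitude–time covariance,
gen 25), and one-shell data ABOVE the dissipation threshold only (`512(1+ε₀)^{16}√(2E₀) ≥ 1`; the sign-free small-datum
envelope, gen 25).  Nothing is asserted.  Two theorems record its position: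

* `taoLadderTarget_of_KPLargeDataSmallRatioCeiling` — with the closed `OrthantInvariance` and the two declared residuals
  `NonDiagonalOrthantBreak` (stmt-27000), `NonOrthantBreak` (stmt-24640) it gives the leaf `Theses.TaoLadderRungTwoBreak.Target`
  (so it can replace the crux in the route's deciding theorem);
* `kpLargeDataSmallRatioCeiling_of_forwardTailCeilingKP` — it is implied by the typed crux (nothing is lost).

HONEST FRAMING: a statement about Tao-type MODEL lattice ODEs (route SubOnsagerCeiling, rung TL-M2Break); it is OPEN (it contains
the large-data behaviour of every recurrent KP network proper at small ratio — the cascade-front regime); nothing here bears on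
Navier–Stokes regularity and no stub, crux or summit is proved.
[cite: Tao2016AveragedNS, §4 Lemma 4.1 (4.5), (4.8), (4.13), Thm. 4.2] [cite: BarbatoMorandinRomito2011, §3.2 (shape of the barrier)]
-/

noncomputable section

-- the summit and its single sub-problem share the name (CONVENTIONS §1)
set_option linter.dupNamespace false

open Set

namespace Summit.NavierStokesRegularity.NavierStokesRegularity.Theorems.SubOnsagerCeiling

open Literature.Analysis.FluidPDE Literature.Analysis.FluidPDE.TaoCascade
open Summit.NavierStokesRegularity.NavierStokesRegularity.Theses.SubOnsagerCeiling

/-- **The large-data, unit-viscosity, small-ratio KP forward-source ceiling** (candidate re-typing of the crux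
`ForwardTailCeilingKP`, item 27057): for every spread `R ≥ 1` there is `εR > 0` such that for every `ε₀ ∈ (0, εR]` and every
KP network proper `α ∈ E₂(R)` (Tao's class, orthant sign condition, diagonal feeds) there are a set `S` containing every forward
source, an exponent `θ > 1/2` and a constant `C ≥ 0` with
`Σ_{k=n..N} Σ_{i∈S} ½X_{i,k}(t)² ≤ C·E₀·(1+ε₀)^{-2θn}` along every honest solution of the UNIT-viscosity model lattice
`X' = quadTerm ε₀ α X − (1+ε₀)^{2k}X` on `[0,s]` from every one-shell datum `X₀` with `512(1+ε₀)^{16}√(2E₀) ≥ 1`,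
`E₀ = Σ_j ½X₀_j²` (no shells below `0`, Tao's weight bound (4.5), continuous, non-negative on shells `≥ 1`).
[this file; route SubOnsagerCeiling] -/
def KPLargeDataSmallRatioCeiling : Prop :=
  ∀ R : ℝ, 1 ≤ R → ∃ εR : ℝ, 0 < εR ∧ ∀ ε₀ : ℝ, 0 < ε₀ → ε₀ ≤ εR →
    ∀ α : Fin 4 → Fin 4 → Fin 4 → ℤ × ℤ × ℤ → ℝ,
    InTableClass R α →
    (∀ (Y : Fin 4 → ℤ → ℝ → ℝ) (τ : ℝ), (∀ (j : Fin 4) (k : ℤ), 1 ≤ k → 0 ≤ Y j k τ) → ∀ δ : ℝ, 0 < δ →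
      ∀ (i : Fin 4) (n : ℤ), 1 ≤ n → Y i n τ = 0 → 0 ≤ quadTerm δ α Y i n τ) →
    (∀ a b i : Fin 4, a ≠ b → α a b i (0, 0, 1) = 0) →
    ∃ S : Finset (Fin 4), (∀ i, i ∉ S → ∀ j l : Fin 4, α i j l (0, 0, 1) = 0) ∧
    ∃ θ : ℝ, 1 / 2 < θ ∧ ∃ C : ℝ, 0 ≤ C ∧ ∀ (X₀ : Fin 4 → ℝ) (s : ℝ), 0 < s →
      1 ≤ 512 * (1 + ε₀) ^ (16 : ℝ) * Real.sqrt (2 * ∑ j : Fin 4, (1 / 2 : ℝ) * X₀ j ^ 2) →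
      ∀ X : Fin 4 → ℤ → ℝ → ℝ,
      (∀ (i : Fin 4) (k : ℤ), X i k 0 = if k = 0 then X₀ i else 0) →
      (∀ (i : Fin 4) (k : ℤ), k < 0 → ∀ t : ℝ, X i k t = 0) →
      (∃ M : ℝ, ∀ (t : ℝ) (i : Fin 4) (k : ℤ), (1 + (1 + ε₀) ^ ((10 : ℝ) * k)) * |X i k t| ≤ M) →
      (∀ (i : Fin 4) (k : ℤ), Continuous (X i k)) →
      (∀ (i : Fin 4) (k : ℤ), ∀ t ∈ Icc (0 : ℝ) s, HasDerivWithinAt (X i k)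
        (quadTerm ε₀ α X i k t - (1 + ε₀) ^ ((2 : ℝ) * k) * X i k t) (Icc (0 : ℝ) s) t) →
      (∀ t ∈ Icc (0 : ℝ) s, ∀ (i : Fin 4) (k : ℤ), 1 ≤ k → 0 ≤ X i k t) →
      ∀ n N : ℕ, n ≤ N → ∀ t ∈ Icc (0 : ℝ) s,
        ∑ k ∈ Finset.Icc n N, ∑ i ∈ S, (1 / 2 : ℝ) * X i (k : ℤ) t ^ 2 ≤
          C * (∑ i : Fin 4, (1 / 2 : ℝ) * X₀ i ^ 2) * (1 + ε₀) ^ (-(2 * θ * (n : ℝ)))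

/-- The named ceiling, with the closed `OrthantInvariance` and the residuals `NonDiagonalOrthantBreak`, `NonOrthantBreak`,
gives the leaf `TaoLadderRungTwoBreak.Target` (the landed reduction, by name). [cite: Tao2016AveragedNS, §4 Thm. 4.2] -/
theorem taoLadderTarget_of_KPLargeDataSmallRatioCeiling (hL : KPLargeDataSmallRatioCeiling)
    (h2 : OrthantInvariance) (h5 : NonDiagonalOrthantBreak) (h4 : NonOrthantBreak) :
    Summit.NavierStokesRegularity.NavierStokesRegularity.Theses.TaoLadderRungTwoBreak.Target :=
  LargeData.taoLadderTarget_of_kpLargeDataSmallRatioCeiling hL h2 h5 h4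

/-- **Nothing is lost**: the typed crux `ForwardTailCeilingKP` implies the named ceiling (`εR = 1`, specialise `ν = 1`,
drop the largeness hypothesis). [cite: Tao2016AveragedNS, §4 (4.13)] -/
theorem kpLargeDataSmallRatioCeiling_of_forwardTailCeilingKP (h : ForwardTailCeilingKP) :
    KPLargeDataSmallRatioCeiling := by
  have h' := LargeData.forwardTailCeilingKP_iff_largeDataUnitViscosity.mp h
  intro R hR
  exact ⟨1, one_pos, fun ε₀ h0 h1 α => h' R hR ε₀ h0 h1 α⟩

end Summit.NavierStokesRegularity.NavierStokesRegularity.Theorems.SubOnsagerCeiling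

end
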